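import Summits.NavierStokesRegularity.NavierStokesRegularity.Theorems.TypeICertificateLadderTargetGaussianEnergyIBP
import Summits.NavierStokesRegularity.NavierStokesRegularity.Theorems.TypeICertificateLadderTargetGaussianEnergyBounds
import HarnessLib

/-!
# Crux `NoTypeIBlowup` (stmt-NavierStokesRegularity-1217), line `head-flux-channel`:
  STUB S2c — the Gaussian energy identity `E' = −D − E − ½Ch` (`stub_gaussianEnergyDeriv`)

-- adapted from Cruxes/Target/S2cProof.lean (refuter-drefute), Parts 1 (end) and 3; copied, not
-- imported.

For a Type-I ancient mild field `u` (`IsTypeIAncientMild C u`) with ANY classical pressure `p` on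
`(−∞, 0)`, the pair `U = lerayOrbit u`, `P = lerayOrbitPressure p` solves the backward Leray system
`∂ₛU + ½U + ½(y·∇)U + (U·∇)U + ∇P = ΔU`, `div U = 0` on all of `ℝ × ℝ³`
(`isClassicalNSSolutionOn_Iio_iff_isBackwardLeraySolutionOn`), and the Gaussian energy
`E(s) = ∫ ½|U(s, y)|² e^{−|y|²/4} dy` satisfies, for every `s`,

  `E'(s) = −D(s) − E(s) − ½ Ch(s)`,  `D = ∫ |∇U|²_F g`,  `Ch = ∫ (½|U|² + P)(y·U) g`.

Proof (Giga–Kohn's weighted energy method with the Ornstein–Uhlenbeck weight; the `U ≡ 0`-weight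
case of Pineau–Vicol 2026, (4.1), (7.7)):
* `hasDerivAt_integral_norm_sq_mul_gaussWeight'` — differentiate under the integral sign
  (`hasDerivAt_integral_of_dominated_loc_of_deriv_le`), dominated by `2CK(1 + |y|) g` thanks to the
  rate-class bounds `|U| ≤ C` (`headFlux_norm_lerayOrbit_le`) and the LINEAR GROWTH
  `|∂ₛU| ≤ K(1 + |y|)` (`HeadFluxChannelS2c.exists_norm_deriv_lerayOrbit_le`);
* `integral_inner_leray_mul_gaussWeight'` — insert the equation and integrate by parts three times
  against `g` (helper file `…GaussianEnergyIBP`: `∫⟨V,ΔV⟩g = −∫|DV|²g + ½∫⟨V,DV y⟩g`,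
  `∫⟨V,(V·∇)V⟩g = ¼∫|V|²(y·V)g`, `∫⟨V,∇Q⟩g = ½∫Q(y·V)g`), with the slice bounds `|DU| ≤ K₀`
  (`HeadFluxChannelS2a.exists_norm_fderiv_lerayOrbit_le`), `|D²U| ≤ B₂`, `|∇P| ≤ C₃`,
  `|P(s, y)| ≤ |P(s, 0)| + C₃|y|` (helper file `…GaussianEnergyBounds`);
* bookkeeping `g = e^{−|y|²/4}` (definitional), `∫ ½|U|²g = ½∫|U|²g`.

Lands `--supports stmt-NavierStokesRegularity-1217` (registered stub `stub_gaussianEnergyDeriv`).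
-/

noncomputable section

namespace Summit.NavierStokesRegularity.NavierStokesRegularity.Theorems.HeadFluxChannelS2c

open MeasureTheory Set Filter Topology Function InnerProductSpace
open scoped RealInnerProductSpace Laplacian ContDiff
open Literature.Analysis Literature.Analysis.FluidPDE
open Literature.Analysis.FluidPDE.PineauVicol2026
open Summit.NavierStokesRegularity.NavierStokesRegularity.Theorems
open Summit.NavierStokesRegularity.NavierStokesRegularity.Theorems.SymmetricScarExists.LogtimeBernoulli

section IBP

variable {E : Type*} [NormedAddCommGroup E] [InnerProductSpace ℝ E] [FiniteDimensional ℝ E]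
  [MeasurableSpace E] [BorelSpace E]

/-- **Leray's momentum balance against `⟨V, ·⟩ g`, rate-class version.** For `V ∈ C²`
divergence free with `‖V‖ ≤ A`, `‖DV‖, ‖D²V‖ ≤ B`, `Q ∈ C¹` with `|Q y| ≤ K(1+‖y‖)`, `‖∇Q‖ ≤ B`,
and `T` with `T + ½V + ½(y·∇)V + (V·∇)V + ∇Q = ΔV` pointwise:
`∫ ⟨V, T⟩ g = −(∫ |DV|²_F g + ½ ∫ |V|² g + ½ ∫ (Q + ½|V|²)(y·V) g)`. [folklore] -/
theorem integral_inner_leray_mul_gaussWeight' {V T : E → E} {Q : E → ℝ} (hV : ContDiff ℝ 2 V)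
    (hQ : ContDiff ℝ 1 Q) (hdiv : VectorCalculus.IsDivFree V) {A B K : ℝ}
    (hA : ∀ y, ‖V y‖ ≤ A) (h1 : ∀ y, ‖fderiv ℝ V y‖ ≤ B)
    (h2 : ∀ y, ‖iteratedFDeriv ℝ 2 V y‖ ≤ B) (hQb : ∀ y, |Q y| ≤ K * (1 + ‖y‖))
    (hQg : ∀ y, ‖gradient Q y‖ ≤ B)
    (heq : ∀ y, T y + (1 / 2 : ℝ) • V y + (1 / 2 : ℝ) • fderiv ℝ V y y + convect V V y +
      gradient Q y = (1 : ℝ) • (Δ V) y) :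
    ∫ y, ⟪V y, T y⟫ * gaussWeight y =
      -((∫ y, frobeniusNormSq (fderiv ℝ V y) * gaussWeight y) +
        (1 / 2 : ℝ) * (∫ y, ‖V y‖ ^ 2 * gaussWeight y) +
        (1 / 2 : ℝ) * ∫ y, (Q y + (1 / 2 : ℝ) * ‖V y‖ ^ 2) * ⟪y, V y⟫ * gaussWeight y) := by
  have hV1 : ContDiff ℝ 1 V := hV.of_le one_le_two
  have hA0 : 0 ≤ A := (norm_nonneg _).trans (hA 0)
  have hB0 : 0 ≤ B := (norm_nonneg _).trans (h1 0)
  have cV : Continuous V := hV.continuous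
  have cDV : Continuous (fderiv ℝ V) := hV.continuous_fderiv two_ne_zero
  have hpt : ∀ y, ⟪V y, T y⟫ * gaussWeight y =
      ⟪V y, (Δ V) y⟫ * gaussWeight y - (1 / 2 : ℝ) * (‖V y‖ ^ 2 * gaussWeight y) -
        (1 / 2 : ℝ) * (⟪V y, fderiv ℝ V y y⟫ * gaussWeight y) -
        ⟪V y, fderiv ℝ V y (V y)⟫ * gaussWeight y - ⟪V y, gradient Q y⟫ * gaussWeight y := by
    intro y
    have e : T y = (Δ V) y - (1 / 2 : ℝ) • V y - (1 / 2 : ℝ) • fderiv ℝ V y y - convect V V y -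
        gradient Q y := by
      have h := heq y; rw [one_smul] at h
      rw [← h]; abel
    rw [e, convect_apply]
    simp only [inner_sub_right, inner_smul_right, real_inner_self_eq_norm_sq]
    ring
  have i1 : Integrable fun y => ⟪V y, (Δ V) y⟫ * gaussWeight y := by
    refine integrable_inner_mul_gaussWeight (B := Module.finrank ℝ E * B) cV
      (continuous_laplacian hV) hA fun y => ?_
    calc ‖(Δ V) y‖ ≤ Module.finrank ℝ E * ‖fderiv ℝ (fderiv ℝ V) y‖ := norm_laplacian_le V y
      _ ≤ Module.finrank ℝ E * B := by
          refine mul_le_mul_of_nonneg_left ?_ (Nat.cast_nonneg _)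
          rw [← norm_iteratedFDeriv_one (𝕜 := ℝ) (fderiv ℝ V), norm_iteratedFDeriv_fderiv]
          exact h2 y
  have i2 : Integrable fun y => ‖V y‖ ^ 2 * gaussWeight y := integrable_norm_sq_mul_gaussWeight' cV hA
  have i3 : Integrable fun y => ⟪V y, fderiv ℝ V y y⟫ * gaussWeight y :=
    integrable_inner_fderiv_apply_id_mul_gaussWeight' hV1 hA h1
  have i4 : Integrable fun y => ⟪V y, fderiv ℝ V y (V y)⟫ * gaussWeight y :=
    integrable_inner_mul_gaussWeight cV (cDV.clm_apply cV) hA fun y =>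
      (ContinuousLinearMap.le_opNorm _ _).trans (mul_le_mul (h1 y) (hA y) (norm_nonneg _) hB0)
  have i5 : Integrable fun y => ⟪V y, gradient Q y⟫ * gaussWeight y :=
    integrable_inner_mul_gaussWeight cV (continuous_gradient_of_contDiff hQ) hA hQg
  have i6 : Integrable fun y => Q y * ⟪y, V y⟫ * gaussWeight y :=
    integrable_mul_inner_id_mul_gaussWeight' hQ.continuous cV hQb hA
  have i7 : Integrable fun y => ‖V y‖ ^ 2 * ⟪y, V y⟫ * gaussWeight y :=
    integrable_norm_sq_mul_inner_id_mul_gaussWeight' cV hA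
  have hL := integral_inner_laplacian_mul_gaussWeight' hV hA h1 h2
  have hC := integral_inner_convect_mul_gaussWeight' hV1 hdiv hA h1
  have hP := integral_inner_gradient_mul_gaussWeight' hV1 hQ hdiv hA hQb hQg
  have hH : ∫ y, (Q y + (1 / 2 : ℝ) * ‖V y‖ ^ 2) * ⟪y, V y⟫ * gaussWeight y =
      (∫ y, Q y * ⟪y, V y⟫ * gaussWeight y) +
        (1 / 2 : ℝ) * ∫ y, ‖V y‖ ^ 2 * ⟪y, V y⟫ * gaussWeight y := by
    rw [← integral_const_mul, ← integral_add i6 (i7.const_mul _)]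
    exact integral_congr_ae (Eventually.of_forall fun y => by simp only; ring)
  have j2 : Integrable fun y => ⟪V y, (Δ V) y⟫ * gaussWeight y -
      (1 / 2 : ℝ) * (‖V y‖ ^ 2 * gaussWeight y) := i1.sub (i2.const_mul _)
  have j3 : Integrable fun y => ⟪V y, (Δ V) y⟫ * gaussWeight y -
      (1 / 2 : ℝ) * (‖V y‖ ^ 2 * gaussWeight y) -
      (1 / 2 : ℝ) * (⟪V y, fderiv ℝ V y y⟫ * gaussWeight y) := j2.sub (i3.const_mul _)
  have j4 : Integrable fun y => ⟪V y, (Δ V) y⟫ * gaussWeight y -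
      (1 / 2 : ℝ) * (‖V y‖ ^ 2 * gaussWeight y) -
      (1 / 2 : ℝ) * (⟪V y, fderiv ℝ V y y⟫ * gaussWeight y) -
      ⟪V y, fderiv ℝ V y (V y)⟫ * gaussWeight y := j3.sub i4
  simp_rw [hpt]
  rw [integral_sub j4 i5, integral_sub j3 i4, integral_sub j2 (i3.const_mul _),
    integral_sub i1 (i2.const_mul _), integral_const_mul, integral_const_mul, hL, hC, hP, hH]
  ring


/-- **Differentiating the Gaussian energy under the integral sign, linearly growing `∂ₛU`.**
For `U` jointly smooth on `ℝ × E` with `‖U‖ ≤ C`, `‖∂ₛU(s, y)‖ ≤ K(1 + ‖y‖)`,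
`s ↦ ∫ |U(s)|² g` has derivative `∫ 2⟨U(s), ∂ₛU(s)⟩ g` (dominated by `2CK(1+‖y‖) g`). [folklore] -/
theorem hasDerivAt_integral_norm_sq_mul_gaussWeight' {U : ℝ → E → E}
    (hU : IsSmoothSpaceTimeOn univ U) {C K : ℝ} (hC : ∀ s y, ‖U s y‖ ≤ C)
    (hK : ∀ s y, ‖deriv (fun σ => U σ y) s‖ ≤ K * (1 + ‖y‖)) (s : ℝ) :
    HasDerivAt (fun σ => ∫ y, ‖U σ y‖ ^ 2 * gaussWeight y)
      (∫ y, 2 * ⟪U s y, deriv (fun σ => U σ y) s⟫ * gaussWeight y) s := by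
  have hC0 : 0 ≤ C := (norm_nonneg _).trans (hC s 0)
  have hK0 : 0 ≤ K := by
    have h := (norm_nonneg _).trans (hK s 0); simpa using h
  have hUt : IsSmoothSpaceTimeOn univ fun t x => deriv (fun σ => U σ x) t :=
    hU.isSmoothSpaceTimeOn_deriv isOpen_univ
  have key := hasDerivAt_integral_of_dominated_loc_of_deriv_le (μ := (volume : Measure E))
    (F := fun σ y => ‖U σ y‖ ^ 2 * gaussWeight y)
    (F' := fun σ y => 2 * ⟪U σ y, deriv (fun τ => U τ y) σ⟫ * gaussWeight y) (x₀ := s)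
    (bound := fun y => 2 * (C * K) * (1 + ‖y‖) ^ 1 * gaussWeight y) (s := univ) univ_mem
    ?_ ?_ ?_ ?_ ?_ ?_
  · exact key.2
  · exact Eventually.of_forall fun σ => (((hU.contDiff_slice (mem_univ σ)).continuous.norm.pow
      2).mul continuous_gaussWeight).aestronglyMeasurable
  · exact integrable_norm_sq_mul_gaussWeight' (hU.contDiff_slice (mem_univ s)).continuous (hC s)
  · exact ((continuous_const.mul ((hU.contDiff_slice (mem_univ s)).continuous.inner
      (hUt.contDiff_slice (mem_univ s)).continuous)).mul continuous_gaussWeight).aestronglyMeasurable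
  · refine Eventually.of_forall fun y σ _ => ?_
    rw [norm_mul, norm_mul, Real.norm_of_nonneg (gaussWeight_pos y).le, Real.norm_of_nonneg zero_le_two,
      pow_one]
    refine mul_le_mul_of_nonneg_right ?_ (gaussWeight_pos y).le
    have h := (norm_inner_le_norm (𝕜 := ℝ) (U σ y) (deriv (fun τ => U τ y) σ)).trans
      (mul_le_mul (hC σ y) (hK σ y) (norm_nonneg _) hC0)
    nlinarith [h]
  · refine integrable_of_norm_le_mul_gaussWeight (M := 2 * (C * K)) ?_ 1 fun y => ?_
    · exact ((continuous_const.mul ((continuous_const.add continuous_norm).pow 1)).mul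
        continuous_gaussWeight).aestronglyMeasurable
    · rw [Real.norm_of_nonneg]
      have := gaussWeight_pos y
      positivity
  · exact Eventually.of_forall fun y σ _ =>
      ((hU.hasDerivAt_timeLine isOpen_univ (mem_univ σ) y).norm_sq).mul_const _

end IBP

end Summit.NavierStokesRegularity.NavierStokesRegularity.Theorems.HeadFluxChannelS2c

/-! ## The stub -/

namespace Summit.NavierStokesRegularity.NavierStokesRegularity.Theorems

open MeasureTheory Set Filter Topology
open scoped RealInnerProductSpace
open Literature.Analysis.FluidPDE

/-- **stub_gaussianEnergyDeriv** (S2c, line `head-flux-channel` of crux `NoTypeIBlowup`) — the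
Gaussian energy identity `E' = −D − E − ½Ch` along the Leray orbit `U = lerayOrbit u`,
`P = lerayOrbitPressure p` of a Type-I ancient mild field `u` with any classical pressure `p` on
`(−∞, 0)`: differentiate under the integral sign, insert the backward Leray system, three weighted
whole-space integrations by parts (Ornstein–Uhlenbeck self-adjointness of `Δ − ½y·∇`, `div U = 0`).
[folklore] -/
theorem stub_gaussianEnergyDeriv :
    ∀ (C : ℝ) (u : ℝ → EuclideanSpace ℝ (Fin 3) → EuclideanSpace ℝ (Fin 3))
      (p : ℝ → EuclideanSpace ℝ (Fin 3) → ℝ),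
      IsTypeIAncientMild C u → IsClassicalNSSolutionOn (Set.Iio 0) 1 0 u p →
      ∀ s : ℝ,
        HasDerivAt (fun σ : ℝ => ∫ y, ‖lerayOrbit u σ y‖ ^ 2 / 2 * Real.exp (-‖y‖ ^ 2 / 4))
          (-(∫ y, frobeniusNormSq (fderiv ℝ (lerayOrbit u s) y) * Real.exp (-‖y‖ ^ 2 / 4))
            - (∫ y, ‖lerayOrbit u s y‖ ^ 2 / 2 * Real.exp (-‖y‖ ^ 2 / 4))
            - (∫ y, (‖lerayOrbit u s y‖ ^ 2 / 2 + lerayOrbitPressure p s y) *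
                ⟪y, lerayOrbit u s y⟫ * Real.exp (-‖y‖ ^ 2 / 4)) / 2) s := by
  intro C u p hu hp s
  have hBL := isClassicalNSSolutionOn_Iio_iff_isBackwardLeraySolutionOn.1 hp
  have hU : IsSmoothSpaceTimeOn univ (lerayOrbit u) := hBL.smooth_velocity
  -- rate-class bounds
  have hUC : ∀ σ y, ‖lerayOrbit u σ y‖ ≤ C := headFlux_norm_lerayOrbit_le hu
  obtain ⟨K₀, hK₀⟩ := HeadFluxChannelS2a.exists_norm_fderiv_lerayOrbit_le C
  obtain ⟨Kd, hKd⟩ := HeadFluxChannelS2c.exists_norm_deriv_lerayOrbit_le hu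
  obtain ⟨C₃, hC₃0, hPg, hPlin⟩ := HeadFluxChannelS2c.lerayOrbitPressure_bounds hu hp
  obtain ⟨B₂, hB₂⟩ := HeadFluxChannelS2c.exists_norm_iteratedFDeriv_two_lerayOrbit_le C
  -- the derivative of `∫ ‖U‖² g`
  have hE := HeadFluxChannelS2c.hasDerivAt_integral_norm_sq_mul_gaussWeight' hU hUC hKd s
  -- the slice identity at time `s`
  set B : ℝ := max (max K₀ B₂) C₃ with hBdef
  have hV : ContDiff ℝ 2 (lerayOrbit u s) := (hBL.contDiff_velocity (mem_univ s)).of_le (by norm_cast)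
  have hQ : ContDiff ℝ 1 (lerayOrbitPressure p s) :=
    (hBL.contDiff_pressure (mem_univ s)).of_le (by norm_cast)
  have h1 : ∀ y, ‖fderiv ℝ (lerayOrbit u s) y‖ ≤ B := fun y =>
    (hK₀ hu s y).trans ((le_max_left _ _).trans (le_max_left _ _))
  have h2 : ∀ y, ‖iteratedFDeriv ℝ 2 (lerayOrbit u s) y‖ ≤ B := fun y =>
    (hB₂ hu s y).trans ((le_max_right _ _).trans (le_max_left _ _))
  have hQg : ∀ y, ‖gradient (lerayOrbitPressure p s) y‖ ≤ B := fun y =>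
    (hPg s y).trans (le_max_right _ _)
  have hQb : ∀ y, |lerayOrbitPressure p s y| ≤ (|lerayOrbitPressure p s 0| + C₃) * (1 + ‖y‖) := by
    intro y
    refine (hPlin s y).trans ?_
    nlinarith [abs_nonneg (lerayOrbitPressure p s 0), hC₃0, norm_nonneg y]
  have heq : ∀ y, deriv (fun τ => lerayOrbit u τ y) s + (1 / 2 : ℝ) • lerayOrbit u s y +
      (1 / 2 : ℝ) • fderiv ℝ (lerayOrbit u s) y y + convect (lerayOrbit u s) (lerayOrbit u s) y +
      gradient (lerayOrbitPressure p s) y = (1 : ℝ) • Laplacian.laplacian (lerayOrbit u s) y := by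
    intro y
    have hm := hBL.momentum_leray (mem_univ s) y
    rwa [timeDerivWithin_apply, derivWithin_univ] at hm
  have hslice := HeadFluxChannelS2c.integral_inner_leray_mul_gaussWeight' hV hQ
    (hBL.divFree s (mem_univ s)) (hUC s) h1 h2 hQb hQg heq
  -- bookkeeping: `g = e^{-‖y‖²/4}`, `∫ ½|U|² g = ½ ∫ |U|² g`, head `½|U|² + P = P + ½|U|²`
  have h2int : ∫ y, 2 * ⟪lerayOrbit u s y, deriv (fun τ => lerayOrbit u τ y) s⟫ *
        PineauVicol2026.gaussWeight y =
      2 * ∫ y, ⟪lerayOrbit u s y, deriv (fun τ => lerayOrbit u τ y) s⟫ *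
        PineauVicol2026.gaussWeight y := by
    rw [← integral_const_mul]
    exact integral_congr_ae (Eventually.of_forall fun y => by ring)
  have hfun : (fun σ : ℝ => ∫ y, ‖lerayOrbit u σ y‖ ^ 2 / 2 * Real.exp (-‖y‖ ^ 2 / 4)) =
      fun σ => (1 / 2 : ℝ) * ∫ y, ‖lerayOrbit u σ y‖ ^ 2 * PineauVicol2026.gaussWeight y := by
    funext σ
    rw [← integral_const_mul]
    refine integral_congr_ae (Eventually.of_forall fun y => ?_)
    simp only [PineauVicol2026.gaussWeight]; ring
  have hEs : ∫ y, ‖lerayOrbit u s y‖ ^ 2 / 2 * Real.exp (-‖y‖ ^ 2 / 4) =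
      (1 / 2 : ℝ) * ∫ y, ‖lerayOrbit u s y‖ ^ 2 * PineauVicol2026.gaussWeight y := by
    rw [← integral_const_mul]
    refine integral_congr_ae (Eventually.of_forall fun y => ?_)
    simp only [PineauVicol2026.gaussWeight]; ring
  have hCh : ∫ y, (‖lerayOrbit u s y‖ ^ 2 / 2 + lerayOrbitPressure p s y) *
        ⟪y, lerayOrbit u s y⟫ * Real.exp (-‖y‖ ^ 2 / 4) =
      ∫ y, (lerayOrbitPressure p s y + (1 / 2 : ℝ) * ‖lerayOrbit u s y‖ ^ 2) *
        ⟪y, lerayOrbit u s y⟫ * PineauVicol2026.gaussWeight y :=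
    integral_congr_ae (Eventually.of_forall fun y => by simp only [PineauVicol2026.gaussWeight]; ring)
  have hD : ∫ y, frobeniusNormSq (fderiv ℝ (lerayOrbit u s) y) * Real.exp (-‖y‖ ^ 2 / 4) =
      ∫ y, frobeniusNormSq (fderiv ℝ (lerayOrbit u s) y) * PineauVicol2026.gaussWeight y := rfl
  rw [hfun]
  refine (hE.const_mul (1 / 2 : ℝ)).congr_deriv ?_
  rw [h2int, hslice, hEs, hCh, hD]
  ring

end Summit.NavierStokesRegularity.NavierStokesRegularity.Theorems

end
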